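import Summits.ValiantsHypothesis.ValiantsHypothesis.Theorems.MonotoneRestorationOrbitRestorationQPKeyedBlocksTools
import Summits.ValiantsHypothesis.ValiantsHypothesis.Theorems.MonotoneRestorationOrbitRestorationQPBlockProducts2
import HarnessLib

/-!
# Keyed blocks: sign-twisted symmetric affine products (ORBIT currency, XXI)

Route MonotoneRestoration, crux `OrbitRestorationQP` (stmt-ValiantsHypothesis-18293), namespace
`Summit.ValiantsHypothesis.ValiantsHypothesis.Theorems.KeyedBlocks`.

The KEYED generalisation of the support-block theorem (`SupportBlocks.qpOrbitRestorable_of_untwisted_supportBlocks`),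
which is the tool for the sign-twisted part of the `k = 1` sub-rung (ΠΣ) of the first rung of line
`depth-three-rung` (crux workfile `Cruxes/OrbitRestorationQP/PISIGMA-SUBRUNG.md`).  Besides the support assignment
`supp` one is given a KEY assignment `key ℓ ⊆ supp ℓ` (unit-invariant, equivariant).  Factors are grouped into
SUB-BLOCKS `G_{K,T} = Π{ℓ : key ℓ = K, supp ℓ = T}` inside SUPERBLOCKS `G_K = Π{ℓ : key ℓ = K}`, and two parity
conditions are required, both stated as "a transposition fixes a product":
* (MID) every transposition of `T ∖ K` fixes `G_{K,T}`;
* (TOP) every transposition of `K` fixes `G_K`.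
Then `f = a · Π L` is `QPOrbitRestorable (k + 5)` (`qpOrbitRestorable_of_keyedBlocks`).  With `key = supp` this is
the support-block theorem; with `key ℓ =` the row pair of `x_ik − x_jk` it restores `Π_{i<j,k}(x_ik − x_jk)`
(`n` even), whose support blocks are twisted.  Mechanism: unique factorisation transports sub-blocks and
superblocks up to units (`exists_unit_fibre`); (MID) makes the pointwise stabiliser of `K` act on the sub-blocks of
`K` by an honest permutation after an equivariant rescaling (transport from one representative per
`Sym_(K)`-orbit, `exists_perm_fix_smul_eq`), hence trivially on `G_K`; (TOP) upgrades this to the set-stabiliser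
of `K`; a second transport (one representative superblock per cardinality) feeds the two-level block criterion
`BlockProducts.qpOrbitRestorable_of_blocks₂`.  Everything is proved. [folklore]

## References
* A. Dawar, G. Wilsenach, *Symmetric arithmetic circuits*, ToC 21 (2025), §3.3, Def. 6.1. [DawarWilsenach2025]
-/

noncomputable section

open scoped Classical Pointwise

-- `Summit.ValiantsHypothesis.ValiantsHypothesis.…` is the tree's single-conjunct layout (Sub = Summit).
set_option linter.dupNamespace false

namespace Summit.ValiantsHypothesis.ValiantsHypothesis.Theorems

namespace KeyedBlocks

open Equiv Finset Literature.Computability.AlgebraicComplexity OrbitRestorationQPDepthThreeRung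

variable {n : ℕ}

/-! ### The keyed-block theorem -/

/-- **KEYED BLOCKS: SIGN-TWISTED SYMMETRIC AFFINE PRODUCTS WITH (MID) AND (TOP) ARE ORBIT-RESTORABLE.**  Let
`f = a · Π L ≠ 0` be a product of degree-one forms, invariant under the diagonal action of `Sym(Fin n)`; let
`supp` and `key` be unit-invariant equivariant assignments of finite sets of indices with `key ℓ ⊆ supp ℓ`,
`|supp ℓ| ≤ k`, the pointwise stabiliser of `supp ℓ` fixing `ℓ` (`ℓ ∈ L`).  Suppose
(MID) for all `K, T` every transposition of `T ∖ K` fixes `Π{ℓ ∈ L : key ℓ = K, supp ℓ = T}`, and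
(TOP) for all `K` every transposition of `K` fixes `Π{ℓ ∈ L : key ℓ = K}`.
Then `f` is `QPOrbitRestorable (k + 5)` at level `n`. [folklore; cite: DawarWilsenach2025, §3.3 and Def. 6.1] -/
theorem qpOrbitRestorable_of_keyedBlocks {k : ℕ} (L : Multiset (MvPolynomial (Fin n × Fin n) ℂ)) (a : ℂ)
    (supp key : MvPolynomial (Fin n × Fin n) ℂ → Finset (Fin n))
    (S1 : ∀ (q : MvPolynomial (Fin n × Fin n) ℂ) (u : ℂ), u ≠ 0 → supp (MvPolynomial.C u * q) = supp q)
    (S2 : ∀ (q : MvPolynomial (Fin n × Fin n) ℂ) (σ : Perm (Fin n)), supp (ren σ q) = σ • supp q)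
    (K1 : ∀ (q : MvPolynomial (Fin n × Fin n) ℂ) (u : ℂ), u ≠ 0 → key (MvPolynomial.C u * q) = key q)
    (K2 : ∀ (q : MvPolynomial (Fin n × Fin n) ℂ) (σ : Perm (Fin n)), key (ren σ q) = σ • key q)
    (S3 : ∀ ℓ ∈ L, ∀ τ : Perm (Fin n), (∀ x ∈ supp ℓ, τ x = x) → ren τ ℓ = ℓ)
    (S4 : ∀ ℓ ∈ L, (supp ℓ).card ≤ k) (K3 : ∀ ℓ ∈ L, key ℓ ⊆ supp ℓ)
    (hL1 : ∀ ℓ ∈ L, ℓ.totalDegree = 1) (hf0 : MvPolynomial.C a * L.prod ≠ 0)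
    (hfix : ∀ σ : Perm (Fin n), ren σ (MvPolynomial.C a * L.prod) = MvPolynomial.C a * L.prod)
    (hMID : ∀ (K T : Finset (Fin n)), ∀ x ∈ T \ K, ∀ y ∈ T \ K,
      ren (swap x y) (L.filter fun ℓ => key ℓ = K ∧ supp ℓ = T).prod = (L.filter fun ℓ => key ℓ = K ∧ supp ℓ = T).prod)
    (hTOP : ∀ (K : Finset (Fin n)), ∀ x ∈ K, ∀ y ∈ K,
      ren (swap x y) (L.filter fun ℓ => key ℓ = K).prod = (L.filter fun ℓ => key ℓ = K).prod) :
    QPOrbitRestorable (k + 5) n (MvPolynomial.C a * L.prod) := by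
  -- sub-blocks and superblocks
  set sub : Finset (Fin n) → Finset (Fin n) → Multiset (MvPolynomial (Fin n × Fin n) ℂ) :=
    fun K T => L.filter fun ℓ => key ℓ = K ∧ supp ℓ = T with hsub
  set sup : Finset (Fin n) → Multiset (MvPolynomial (Fin n × Fin n) ℂ) := fun K => L.filter fun ℓ => key ℓ = K
    with hsup
  -- the pair label and its transport
  let lab : MvPolynomial (Fin n × Fin n) ℂ → Finset (Fin n) × Finset (Fin n) := fun q => (key q, supp q)
  have hsub_lab : ∀ K T, sub K T = L.filter fun ℓ => lab ℓ = (K, T) := by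
    intro K T; rw [hsub]; dsimp only
    exact Multiset.filter_congr fun ℓ _ => by simp [lab, Prod.ext_iff]
  have hunit_sub : ∀ (σ : Perm (Fin n)) (K T : Finset (Fin n)), ∃ c : ℂ, c ≠ 0 ∧
      ren σ (sub K T).prod = MvPolynomial.C c * (sub (σ • K) (σ • T)).prod := by
    intro σ K T
    obtain ⟨c, hc0, hc⟩ := exists_unit_fibre lab (fun q u hu => by simp [lab, S1 q u hu, K1 q u hu])
      (fun q σ => by simp [lab, S2, K2]) hL1 hf0 hfix σ (K, T)
    refine ⟨c, hc0, ?_⟩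
    rw [hsub_lab, hsub_lab, hc, Prod.smul_mk]
  have hunit_sup : ∀ (σ : Perm (Fin n)) (K : Finset (Fin n)), ∃ c : ℂ, c ≠ 0 ∧
      ren σ (sup K).prod = MvPolynomial.C c * (sup (σ • K)).prod := fun σ K =>
    exists_unit_fibre key K1 K2 hL1 hf0 hfix σ K
  -- (MID) ⇒ the pointwise stabiliser of `K` meets the set-stabiliser of `T` inside the fixer of `G_{K,T}`
  have hmid : ∀ (K T : Finset (Fin n)) (ρ : Perm (Fin n)), (∀ x ∈ K, ρ x = x) → ρ • T = T →
      ren ρ (sub K T).prod = (sub K T).prod := by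
    intro K T ρ hρK hρT
    by_cases hemp : sub K T = 0
    · rw [hemp, Multiset.prod_zero, map_one]
    obtain ⟨ℓ₀, hℓ₀⟩ := Multiset.exists_mem_of_ne_zero hemp
    have hKT : K ⊆ T := by
      obtain ⟨hℓ₀L, hk, hs⟩ := Multiset.mem_filter.1 hℓ₀
      rw [← hk, ← hs]; exact K3 ℓ₀ hℓ₀L
    refine ren_eq_of_swaps_in (T := T) (D := T \ K) (fun τ hτ => ?_) (fun x hx y hy => hMID K T x hx y hy) ρ ?_
      (fun x hx hxD => hρK x ?_)
    · rw [map_multiset_prod, Multiset.map_congr rfl fun ℓ hℓ => ?_, Multiset.map_id']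
      obtain ⟨hℓL, -, hs⟩ := Multiset.mem_filter.1 hℓ
      exact S3 ℓ hℓL τ (hs ▸ hτ)
    · rw [Finset.smul_finset_sdiff, hρT, smul_eq_of_fix hρK]
    · by_contra hxK; exact hxD (Finset.mem_sdiff.2 ⟨hx, hxK⟩)
  -- exact representatives of the sub-blocks of `K` under the pointwise stabiliser of `K`
  let pick : Finset (Fin n) → ℕ → Finset (Fin n) := fun K m =>
    if h : ∃ S : Finset (Fin n), Disjoint S K ∧ S.card = m then Classical.choose h else ∅
  have hpick : ∀ (K T : Finset (Fin n)), Disjoint (pick K (T \ K).card) K ∧ (pick K (T \ K).card).card = (T \ K).card := by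
    intro K T
    have h : ∃ S : Finset (Fin n), Disjoint S K ∧ S.card = (T \ K).card := ⟨T \ K, Finset.sdiff_disjoint, rfl⟩
    simp only [pick, dif_pos h]
    exact Classical.choose_spec h
  let srep : Finset (Fin n) → Finset (Fin n) → Finset (Fin n) := fun K T => (T ∩ K) ∪ pick K (T \ K).card
  have htrs : ∀ K T : Finset (Fin n), ∃ ρ : Perm (Fin n), (∀ x ∈ K, ρ x = x) ∧ ρ • srep K T = T := by
    intro K T
    obtain ⟨ρ, hρK, hρA⟩ := exists_perm_fix_smul_eq (hpick K T).1 Finset.sdiff_disjoint (hpick K T).2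
    refine ⟨ρ, hρK, ?_⟩
    show ρ • ((T ∩ K) ∪ pick K (T \ K).card) = T
    rw [Finset.smul_finset_union, hρA, smul_eq_of_fix (fun x hx => hρK x (Finset.mem_inter.1 hx).2),
      Finset.union_comm, Finset.sdiff_union_inter]
  choose trs htrsK htrsT using htrs
  have hsrep_inv : ∀ (K T : Finset (Fin n)) (ρ : Perm (Fin n)), (∀ x ∈ K, ρ x = x) → srep K (ρ • T) = srep K T := by
    intro K T ρ hρK
    have h1 : ρ • T ∩ K = T ∩ K := by
      ext x
      simp only [Finset.mem_inter, Finset.mem_smul_finset, Perm.smul_def]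
      constructor
      · rintro ⟨⟨y, hy, hyx⟩, hK⟩
        have hx : ρ x = x := hρK x hK
        have hxy : y = x := ρ.injective (hyx.trans hx.symm)
        exact ⟨hxy ▸ hy, hK⟩
      · rintro ⟨hT, hK⟩; exact ⟨⟨x, hT, hρK x hK⟩, hK⟩
    have h2 : (ρ • T \ K).card = (T \ K).card := by
      rw [show ρ • T \ K = ρ • (T \ K) by rw [Finset.smul_finset_sdiff, smul_eq_of_fix hρK],
        Finset.card_smul_finset]
    show (ρ • T ∩ K) ∪ pick K (ρ • T \ K).card = (T ∩ K) ∪ pick K (T \ K).card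
    rw [h1, h2]
  -- the rescaled sub-blocks
  let Nrep : Finset (Fin n) → Finset (Fin n) → Multiset (MvPolynomial (Fin n × Fin n) ℂ) :=
    fun K T => (sub K (srep K T)).map (ren (trs K T))
  have hNrep_prod : ∀ K T, (Nrep K T).prod = ren (trs K T) (sub K (srep K T)).prod := fun K T => by
    simp only [Nrep, map_multiset_prod]
  have hNrep_exact : ∀ (K T : Finset (Fin n)) (ρ : Perm (Fin n)), (∀ x ∈ K, ρ x = x) →
      ren ρ (Nrep K T).prod = (Nrep K (ρ • T)).prod := by
    intro K T ρ hρK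
    rw [hNrep_prod, hNrep_prod, hsrep_inv K T ρ hρK, ← ren_mul]
    set δ := (trs K (ρ • T))⁻¹ * (ρ * trs K T) with hδ
    have hδK : ∀ x ∈ K, δ x = x := by
      intro x hx
      rw [hδ, Perm.mul_apply, Perm.mul_apply, htrsK K T x hx, hρK x hx, Perm.inv_eq_iff_eq,
        htrsK K (ρ • T) x hx]
    have hδT : δ • srep K T = srep K T := by
      rw [hδ, mul_smul, mul_smul, htrsT K T, inv_smul_eq_iff, ← hsrep_inv K T ρ hρK, htrsT K (ρ • T)]
    calc ren (ρ * trs K T) (sub K (srep K T)).prod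
        = ren (trs K (ρ • T) * δ) (sub K (srep K T)).prod := by rw [hδ, mul_inv_cancel_left]
      _ = ren (trs K (ρ • T)) (sub K (srep K T)).prod := by rw [ren_mul, hmid K _ δ hδK hδT]
  have hNrep_unit : ∀ K T, ∃ c : ℂ, c ≠ 0 ∧ (Nrep K T).prod = MvPolynomial.C c * (sub K T).prod := by
    intro K T
    obtain ⟨c, hc0, hc⟩ := hunit_sub (trs K T) K (srep K T)
    refine ⟨c, hc0, ?_⟩
    rw [hNrep_prod, hc, smul_eq_of_fix (htrsK K T), htrsT K T]
  choose cN hcN0 hcN using hNrep_unit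
  -- the product of all rescaled sub-blocks of `K` is a unit multiple of the superblock
  have hsup_eq : ∀ K : Finset (Fin n), (∏ T : Finset (Fin n), (sub K T).prod) = (sup K).prod := by
    intro K
    have := SupportBlocks.prod_filter_eq_prod supp (sup K)
    rw [hsup] at this ⊢; dsimp only at this ⊢
    rw [← this]
    refine Finset.prod_congr rfl fun T _ => ?_
    rw [hsub]; dsimp only
    rw [Multiset.filter_filter]
    exact congrArg Multiset.prod (Multiset.filter_congr fun ℓ _ => and_comm)
  have hunitK : ∀ K : Finset (Fin n), (∏ T : Finset (Fin n), cN K T) ≠ 0 := fun K =>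
    Finset.prod_ne_zero_iff.2 fun T _ => hcN0 K T
  have hprodNrep : ∀ K : Finset (Fin n), (∏ T : Finset (Fin n), (Nrep K T).prod) =
      MvPolynomial.C (∏ T : Finset (Fin n), cN K T) * (sup K).prod := by
    intro K
    simp only [hcN]
    rw [Finset.prod_mul_distrib, ← map_prod, hsup_eq]
  -- the pointwise stabiliser of `K` fixes the superblock (via the exact representatives) …
  have hsupfix_pt : ∀ (K : Finset (Fin n)) (ρ : Perm (Fin n)), (∀ x ∈ K, ρ x = x) →
      ren ρ (sup K).prod = (sup K).prod := by
    intro K ρ hρK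
    have h1 : ren ρ (∏ T : Finset (Fin n), (Nrep K T).prod) = ∏ T : Finset (Fin n), (Nrep K T).prod := by
      rw [map_prod]
      simp only [hNrep_exact K _ ρ hρK]
      exact Fintype.prod_equiv (MulAction.toPerm ρ) _ _ fun T => rfl
    rw [hprodNrep, map_mul, ren_C] at h1
    exact mul_left_cancel₀ (by rw [Ne, MvPolynomial.C_eq_zero]; exact hunitK K) h1
  -- … and with (TOP) so does its set-stabiliser
  have hsupfix : ∀ (K : Finset (Fin n)) (ρ : Perm (Fin n)), ρ • K = K → ren ρ (sup K).prod = (sup K).prod := by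
    intro K ρ hρ
    exact ren_eq_of_swaps_in (T := K) (D := K) (hsupfix_pt K) (hTOP K) ρ hρ (fun x hx hxK => absurd hx hxK)
  -- representatives of superblocks per cardinality, and their transporters
  let repc : ℕ → Finset (Fin n) := fun t => if h : ∃ S : Finset (Fin n), S.card = t then Classical.choose h else ∅
  have hrepc : ∀ K : Finset (Fin n), (repc K.card).card = K.card := fun K => by
    have h : ∃ S : Finset (Fin n), S.card = K.card := ⟨K, rfl⟩
    simp only [repc, dif_pos h]; exact Classical.choose_spec h
  have hex : ∀ K : Finset (Fin n), ∃ ρ : Perm (Fin n), ρ • repc K.card = K := fun K =>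
    SupportBlocks.exists_perm_smul_eq (hrepc K)
  choose tr htr using hex
  -- the blocks for the two-level criterion
  let M : Finset (Fin n) → Multiset (Multiset (MvPolynomial (Fin n × Fin n) ℂ)) := fun K =>
    (univ : Finset (Finset (Fin n))).val.map fun T => (Nrep (repc K.card) T).map (ren (tr K))
  have hMprods : ∀ K, (M K).map Multiset.prod =
      (univ : Finset (Finset (Fin n))).val.map fun T => ren (tr K) (Nrep (repc K.card) T).prod := by
    intro K; simp only [M, Multiset.map_map, Function.comp_def, map_multiset_prod]
  have hMprod : ∀ K, ((M K).map Multiset.prod).prod =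
      ren (tr K) (∏ T : Finset (Fin n), (Nrep (repc K.card) T).prod) := by
    intro K; rw [hMprods, map_prod, Finset.prod_eq_multiset_prod]
  -- the unit relating the transported representative superblock to the true superblock
  have hMunit : ∀ K, ∃ c : ℂ, c ≠ 0 ∧ ((M K).map Multiset.prod).prod = MvPolynomial.C c * (sup K).prod := by
    intro K
    obtain ⟨c, hc0, hc⟩ := hunit_sup (tr K) (repc K.card)
    refine ⟨(∏ T : Finset (Fin n), cN (repc K.card) T) * c, mul_ne_zero (hunitK _) hc0, ?_⟩
    rw [hMprod, hprodNrep, map_mul, ren_C, hc, htr K, ← mul_assoc, ← map_mul]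
  choose cM hcM0 hcM using hMunit
  have hcMprod : (∏ K : Finset (Fin n), cM K) ≠ 0 := Finset.prod_ne_zero_iff.2 fun K _ => hcM0 K
  have hsupprod : (∏ K : Finset (Fin n), (sup K).prod) = L.prod := by
    simp only [hsup]; exact SupportBlocks.prod_filter_eq_prod key L
  have hf : MvPolynomial.C a * L.prod =
      MvPolynomial.C (a * (∏ K : Finset (Fin n), cM K)⁻¹) * ∏ K : Finset (Fin n), ((M K).map Multiset.prod).prod := by
    have h1 : (∏ K : Finset (Fin n), ((M K).map Multiset.prod).prod) =
        MvPolynomial.C (∏ K : Finset (Fin n), cM K) * L.prod := by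
      simp only [hcM]; rw [Finset.prod_mul_distrib, ← map_prod, hsupprod]
    rw [h1, ← mul_assoc, ← map_mul, show a * (∏ K : Finset (Fin n), cM K)⁻¹ * ∏ K : Finset (Fin n), cM K = a by
      rw [mul_assoc, inv_mul_cancel₀ hcMprod, mul_one]]
  rw [hf]
  refine BlockProducts.qpOrbitRestorable_of_blocks₂ (k := k) M _ (fun K N hN q hq => ?_) (fun K N hN => ?_)
    (fun K => ?_) (fun σ K => ?_)
  · -- affine
    simp only [M, Multiset.mem_map, Finset.mem_val, Finset.mem_univ, true_and] at hN
    obtain ⟨T, rfl⟩ := hN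
    simp only [Nrep, Multiset.map_map, Function.comp_apply, Multiset.mem_map] at hq
    obtain ⟨ℓ, hℓ, rfl⟩ := hq
    rw [← ren_mul, AffineFactors.totalDegree_ren, hL1 ℓ (Multiset.mem_filter.1 hℓ).1]
  · -- common support of a sub-block
    simp only [M, Multiset.mem_map, Finset.mem_val, Finset.mem_univ, true_and] at hN
    obtain ⟨T, rfl⟩ := hN
    set K₀ := repc K.card with hK₀
    by_cases hemp : sub K₀ (srep K₀ T) = 0
    · refine ⟨∅, by simp, fun q hq => ?_⟩
      simp only [Nrep, hemp, Multiset.map_zero, Multiset.notMem_zero] at hq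
    obtain ⟨ℓ₀, hℓ₀⟩ := Multiset.exists_mem_of_ne_zero hemp
    obtain ⟨hℓ₀L, -, hℓ₀s⟩ := Multiset.mem_filter.1 hℓ₀
    refine ⟨(tr K * trs K₀ T) • srep K₀ T, ?_, fun q hq τ hτ => ?_⟩
    · rw [Finset.card_smul_finset, ← hℓ₀s]; exact S4 ℓ₀ hℓ₀L
    · simp only [Nrep, Multiset.map_map, Function.comp_apply, Multiset.mem_map] at hq
      obtain ⟨ℓ, hℓ, rfl⟩ := hq
      obtain ⟨hℓL, -, hℓs⟩ := Multiset.mem_filter.1 hℓ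
      set θ := tr K * trs K₀ T with hθ
      have e : ren (tr K) (ren (trs K₀ T) ℓ) = ren θ ℓ := by rw [hθ, ren_mul]
      rw [e]
      have hfix' : ren (θ⁻¹ * τ * θ) ℓ = ℓ := S3 ℓ hℓL _ fun x hx => by
        have h1 : τ (θ • x) = θ • x := hτ (θ • x) (by rw [← hℓs]; exact Finset.smul_mem_smul_finset hx)
        rw [Perm.smul_def] at h1
        rw [Perm.mul_apply, Perm.mul_apply, h1]; exact θ.symm_apply_apply x
      calc ren τ (ren θ ℓ) = ren (τ * θ) ℓ := (ren_mul τ θ ℓ).symm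
        _ = ren (θ * (θ⁻¹ * τ * θ)) ℓ := by rw [show θ * (θ⁻¹ * τ * θ) = τ * θ by group]
        _ = ren θ (ren (θ⁻¹ * τ * θ) ℓ) := ren_mul _ _ _
        _ = ren θ ℓ := by rw [hfix']
  · -- the sub-block products of `K` are exactly permuted by the pointwise stabiliser of `K`
    set K₀ := repc K.card with hK₀
    have hperm : ∀ σ : Perm (Fin n), (∀ x ∈ K, σ x = x) →
        ((M K).map Multiset.prod).map (ren σ) = (M K).map Multiset.prod := by
      intro σ hσ
      rw [hMprods, Multiset.map_map]
      set σ' := (tr K)⁻¹ * σ * tr K with hσ'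
      have hσ'K : ∀ x ∈ K₀, σ' x = x := by
        intro x hx
        have hxK : tr K x ∈ K := by
          have h := Finset.smul_mem_smul_finset (a := tr K) hx
          rw [htr K, Perm.smul_def] at h
          exact h
        rw [hσ', Perm.mul_apply, Perm.mul_apply, hσ _ hxK]; exact (tr K).symm_apply_apply x
      have hc : (ren σ ∘ fun T => ren (tr K) (Nrep K₀ T).prod) =
          (fun T => ren (tr K) (Nrep K₀ T).prod) ∘ (MulAction.toPerm σ') := by
        funext T
        simp only [Function.comp_apply, MulAction.toPerm_apply]
        rw [← hNrep_exact K₀ T σ' hσ'K, ← ren_mul, ← ren_mul, show tr K * σ' = σ * tr K by rw [hσ']; group]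
      rw [hc, ← Multiset.map_map, Multiset.map_univ_val_equiv]
    by_cases hne : ∃ T, sub K₀ (srep K₀ T) ≠ 0
    · obtain ⟨T₁, hT₁⟩ := hne
      obtain ⟨ℓ₀, hℓ₀⟩ := Multiset.exists_mem_of_ne_zero hT₁
      obtain ⟨hℓ₀L, hℓ₀k, -⟩ := Multiset.mem_filter.1 hℓ₀
      refine ⟨K, ?_, hperm⟩
      calc K.card = K₀.card := (hrepc K).symm
        _ ≤ (supp ℓ₀).card := by rw [← hℓ₀k]; exact Finset.card_le_card (K3 ℓ₀ hℓ₀L)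
        _ ≤ k := S4 ℓ₀ hℓ₀L
    · refine ⟨∅, by simp, fun σ _ => ?_⟩
      simp only [not_exists, not_not] at hne
      rw [hMprods, Multiset.map_map]
      refine Multiset.map_congr rfl fun T _ => ?_
      have h0 : (Nrep K₀ T).prod = 1 := by
        show ((sub K₀ (srep K₀ T)).map (ren (trs K₀ T))).prod = 1
        rw [hne T, Multiset.map_zero, Multiset.prod_zero]
      simp only [Function.comp_apply]
      rw [show (Multiset.map (⇑(ren (trs (repc K.card) T))) (sub (repc K.card) (srep (repc K.card) T))).prod = 1
        from h0, map_one, map_one]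
  · -- equivariance of the superblock products
    rw [hMprod, hMprod, ← ren_mul, Finset.card_smul_finset]
    set K₀ := repc K.card with hK₀
    have h1 : tr (σ • K) • K₀ = σ • K := by
      have := htr (σ • K); rwa [Finset.card_smul_finset] at this
    have hρ : ((tr (σ • K))⁻¹ * (σ * tr K)) • K₀ = K₀ := by
      rw [mul_smul, mul_smul, htr K, inv_smul_eq_iff, h1]
    have hfixrep : ren ((tr (σ • K))⁻¹ * (σ * tr K)) (∏ T : Finset (Fin n), (Nrep K₀ T).prod) =
        ∏ T : Finset (Fin n), (Nrep K₀ T).prod := by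
      rw [hprodNrep, map_mul, ren_C, hsupfix K₀ _ hρ]
    calc ren (σ * tr K) (∏ T : Finset (Fin n), (Nrep K₀ T).prod)
        = ren (tr (σ • K) * ((tr (σ • K))⁻¹ * (σ * tr K))) (∏ T : Finset (Fin n), (Nrep K₀ T).prod) := by
          rw [mul_inv_cancel_left]
      _ = ren (tr (σ • K)) (∏ T : Finset (Fin n), (Nrep K₀ T).prod) := by rw [ren_mul, hfixrep]

end KeyedBlocks

end Summit.ValiantsHypothesis.ValiantsHypothesis.Theorems

end
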